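import Literature.NumberTheory.LFunctions.IwaniecSarnakFamilyLevelClass
import HarnessLib

/-!
# The parity-constant square tower `N = q·n²` as typed by the §D fam card
# `fam-nonresidue-square-tower` (its first rung, verbatim, on the level-class socket)

Topic `Literature/NumberTheory/LFunctions` (namespace
`Literature.NumberTheory.LFunctions.CentralValueFamilyHalfEdge.SquareTower`). Cell `landau-siegel`,
§D typer (edge fam = the ½-proportion edge); card `fam-nonresidue-square-tower` (ls-knife-fam-idea-2,
filed 2026-08-27T00:29Z, commit c2cc9dfe1466; draft `knife/fam/idea-2/CARD-…`, Sketch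
`Sketch-fam-nonresidue-square-tower.lean`). Vocabulary + kernel algebra only: no named fact, no
claim about the edge.

The card's averaging set is the tower of levels `N = q·n²` (`q = 1` or `q` prime, `n` squarefree,
`(n, q) = 1`, `q⁸ ≤ N`) on which the Iwaniec–Sarnak compatibility sign `χ_D(−N)` is CONSTANT
(`χ(−q n²) = χ(−q)` for `(n, D) = 1`, (4.10) [IwaniecConversations2006, §4]); its edge is the
level-averaged E*-fam statement over the window of tower levels `N ∈ [X, 2X]`, `(N, D) = 1`,
`χ_D(−N) = 1` (which keeps or discards each `q`-tower as a whole). This file lands the card's own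
decls on the tree socket `iwaniecSarnakFamilyOn` (`IwaniecSarnakFamilyLevelClass`):

* `chi_neg_mul_sq`, `chi_neg_towerLevel`, `tower_compatible` (card P2, PROVED — the parity-constant
  tower; cf. the socket's `compatible_towerLevel_iff`);
* `IsTowerLevel` (the card's level type), `towerFamily k := iwaniecSarnakFamilyOn k IsTowerLevel`
  (`towerFamily_eq`: it IS the card's `{ iwaniecSarnakFamily k with Admissible := IsTowerLevel }`,
  `rfl`), the card's window `towerWindow` (tower levels in `[⌈X⌉, ⌊2X⌋]`, coprime to `D`,
  `χ(−N) = 1`), `towerWindow_compatible` (PROVED), `mem_towerWindow` and `windowBound_towerWindow`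
  (the `WindowBound … 2` half of the card's K4, PROVED), `towerFamily_nonnegOn` (Lapid–Rallis);
* the TARGET `TowerEdge k η δ := (towerFamily k).EStarFamLevelAvg ((towerFamily k).ntWindow
  towerWindow) (1/2 + η) 2 δ` — the card's K1 «E*-fam-□», OPEN — and the decision displays
  `lOne_lowerBound_of_towerEdge` / `lOneLowerBound_four_of_towerEdge`: Lapid–Rallis + K4
  (`EvenShareAvg`) + K3 (`MixedOverTotalMassAvg`, `TwistedHalfAvg … (1/2 − ε) 2 δ`, `ε < η`) +
  K1 ⊢ `∃ c > 0, L(1,χ_D) ≥ c (log D)⁻⁴` eventually, i.e. `Zhang2022.Skeleton.LOneLowerBound 4`;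
* `exists_param_of_avg` (card P3, PROVED: a window average `≥ c` is attained at some level).

The card's K2 (TowerOffDiag(κ): a D-free bilinear bound for Kloosterman sums to square moduli /
modular square roots) and P1 (`SalieEvaluationSq`, the exact evaluation `S(a,b;p²) =
p·Σ_{w² = ab} e(2w/p²)`) are NOT typed here (K2: mollified second moment over `⋃_n H_k(q n²)` has
no tree vocabulary yet; P1: a Literature fact to be read on the page of IK §12.3 — next file).

WHAT THIS IS NOT: no claim that `TowerEdge` holds. «The programme SEARCHES and TYPES; no claim about
Landau–Siegel zeros, Theorems 1–2 of arXiv:2211.02515 or a repaired Margin232 until a kernel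
theorem says so.»

## References

* [IwaniecConversations2006] H. Iwaniec, *Conversations on the exceptional character*, LNM 1891
  (2006), §4 (4.10) p. 89; §7 (7.3)–(7.7) pp. 95–97 (held p0089, p0095–p0097: «if one installs this
  condition to averaging over the level … the excess over 50% disappears», p0097:L15).
* [LapidRallis2003] E. Lapid, S. Rallis, Ann. of Math. 157 (2003), Thm. 1 (n = 2) — tree fact
  `IwaniecSarnak.lapidRallis2003_theorem1_gl2Twist`.
* Tree: `IwaniecSarnakFamilyLevelClass` (p478245), `CentralValueFamilyLevelAvgTotal` (p468411),
  `CentralValueFamilyToZeroFreeRegion` (p470348).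
-/

noncomputable section

namespace Literature.NumberTheory.LFunctions.CentralValueFamilyHalfEdge.SquareTower

open Finset
open scoped MatrixGroups
open CongruenceSubgroup
open Literature.NumberTheory.EllipticCurves.ModularForms
open Literature.NumberTheory.LFunctions.IwaniecSarnak
open Literature.NumberTheory.LFunctions.Zhang2022

/-! ## Tower compatibility (card P2) -/

/-- A quadratic character takes the same value at `−(q n²)` and `−q` when `n` is a unit: the
compatibility sign (4.10) is constant on the tower. [cite: IwaniecConversations2006, §4 (4.10)] -/
theorem chi_neg_mul_sq {D : ℕ} (χ : DirichletCharacter ℂ D) (hχ : MulChar.IsQuadratic χ)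
    (q n : ZMod D) (hn : IsUnit n) : χ (-(q * n ^ 2)) = χ (-q) := by
  have h1 : χ n ^ 2 = 1 := by
    rcases hχ n with h | h | h
    · exact absurd h (hn.map χ).ne_zero
    · simp [h]
    · simp [h]
  rw [show -(q * n ^ 2) = -q * n ^ 2 by ring, map_mul, map_pow, h1, mul_one]

/-- The compatibility sign `χ(−N)` is constant on the tower `N = q n²`, `(n, D) = 1`.
[cite: IwaniecConversations2006, §4 (4.10)] -/
theorem chi_neg_towerLevel {D : ℕ} (χ : DirichletCharacter ℂ D) (hχ : MulChar.IsQuadratic χ)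
    (q n : ℕ) (hn : IsUnit ((n : ℕ) : ZMod D)) :
    χ (-((q * n ^ 2 : ℕ) : ZMod D)) = χ (-(q : ZMod D)) := by
  rw [Nat.cast_mul, Nat.cast_pow]
  exact chi_neg_mul_sq χ hχ _ _ hn

/-- Hence: if `χ(−q) = 1` the whole `q`-tower is compatible. [cite: IwaniecConversations2006, §4 (4.10)] -/
theorem tower_compatible {D : ℕ} (χ : DirichletCharacter ℂ D) (hχ : MulChar.IsQuadratic χ)
    {q : ℕ} (hq : χ (-(q : ZMod D)) = 1) (n : ℕ) (hn : IsUnit ((n : ℕ) : ZMod D)) :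
    χ (-((q * n ^ 2 : ℕ) : ZMod D)) = 1 := by
  rw [chi_neg_towerLevel χ hχ q n hn, hq]

/-! ## The level type, the datum and the window scheme (card: First lemma) -/

/-- **Tower levels** (the card's level type): `N = q·n²` with `q = 1` or `q` prime, `n` squarefree
and coprime to `q`, and the cofactor small, `q⁸ ≤ N` (Burgess supplies `q_D ≤ D^{1/(4√e)+ε}`).
[cite: IwaniecConversations2006, §7 (p. 95, the admissible levels)] -/
def IsTowerLevel (N : ℕ) : Prop :=
  ∃ q n : ℕ, (q = 1 ∨ q.Prime) ∧ Squarefree n ∧ n.Coprime q ∧ q ^ 8 ≤ N ∧ N = q * n ^ 2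

/-- **`𝓗_k(q n²)` as a `CentralValueFamily`** (the card's `towerFamily`): the Iwaniec–Sarnak datum
with admissible = tower level, i.e. the level-class datum `iwaniecSarnakFamilyOn k IsTowerLevel`.
[cite: IwaniecConversations2006, §7 (7.1)–(7.6)] -/
abbrev towerFamily (k : ℤ) : CentralValueFamily :=
  iwaniecSarnakFamilyOn k (fun N => IsTowerLevel ((N : ℕ+) : ℕ))

/-- `towerFamily k` IS the card's structure update `{ iwaniecSarnakFamily k with Admissible :=
IsTowerLevel }`. [cite: IwaniecConversations2006, §7 (7.1)–(7.6)] -/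
theorem towerFamily_eq (k : ℤ) :
    towerFamily k =
      { iwaniecSarnakFamily k with Admissible := fun N => IsTowerLevel ((N : ℕ+) : ℕ) } := rfl

/-- Non-negativity on the tower datum (Lapid–Rallis, every level). [cite: LapidRallis2003, Thm. 1 (case n = 2)] -/
theorem towerFamily_nonnegOn {k : ℤ} (hk : 2 ≤ k) (h : lapidRallis2003_theorem1_gl2Twist) :
    (towerFamily k).NonnegOn :=
  iwaniecSarnakFamilyOn_nonnegOn hk h

open scoped Classical in
/-- **The tower window** at scale `X` for `χ mod D` (the card's `towerWindow`): tower levels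
`N ∈ [⌈X⌉, ⌊2X⌋]` coprime to `D` with `χ(−N) = 1` — by `chi_neg_towerLevel` this keeps or discards
each `q`-tower as a whole. [cite: IwaniecConversations2006, §7 (p0097:L15)] -/
def towerWindow (X : ℝ) (D : ℕ) (χ : DirichletCharacter ℂ D) : Finset ℕ+ :=
  (Finset.Icc (Nat.toPNat' ⌈X⌉₊) (Nat.toPNat' ⌊2 * X⌋₊)).filter
    (fun N => IsTowerLevel (N : ℕ) ∧ (N : ℕ).Coprime D ∧ χ (-((N : ℕ) : ZMod D)) = 1)

/-- Members of the tower window: tower levels, coprime to `D`, `χ(−N) = 1`, and `X ≤ N ≤ 2X` once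
`X ≥ 1`. [cite: IwaniecConversations2006, §7 (p0097:L15)] -/
theorem mem_towerWindow {X : ℝ} (hX : 1 ≤ X) {D : ℕ} {χ : DirichletCharacter ℂ D} {N : ℕ+}
    (hN : N ∈ towerWindow X D χ) :
    IsTowerLevel (N : ℕ) ∧ (N : ℕ).Coprime D ∧ χ (-((N : ℕ) : ZMod D)) = 1 ∧
      X ≤ ((N : ℕ) : ℝ) ∧ ((N : ℕ) : ℝ) ≤ 2 * X := by
  classical
  rw [towerWindow, Finset.mem_filter, Finset.mem_Icc] at hN
  obtain ⟨⟨h1, h2⟩, htow, hcop, hχ⟩ := hN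
  have hc1 : 0 < ⌈X⌉₊ := Nat.ceil_pos.mpr (by linarith)
  have hf1 : 0 < ⌊2 * X⌋₊ := Nat.floor_pos.mpr (by linarith)
  have h1' : ⌈X⌉₊ ≤ (N : ℕ) := by
    have := PNat.coe_le_coe _ _ |>.mpr h1
    rwa [PNat.toPNat'_coe hc1] at this
  have h2' : (N : ℕ) ≤ ⌊2 * X⌋₊ := by
    have := PNat.coe_le_coe _ _ |>.mpr h2
    rwa [PNat.toPNat'_coe hf1] at this
  refine ⟨htow, hcop, hχ, le_trans (Nat.le_ceil X) (by exact_mod_cast h1'), ?_⟩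
  exact le_trans (by exact_mod_cast h2') (Nat.floor_le (by linarith))

/-- Members of the tower window are compatible (the card's `towerWindow_compatible`; any `δ`).
[cite: IwaniecConversations2006, §4 (4.10)] -/
theorem towerWindow_compatible (k : ℤ) (δ : ℝ) :
    (towerFamily k).WindowCompatible towerWindow δ := by
  classical
  refine ⟨0, fun X _ D _ χ _ _ _ P hP => ?_⟩
  simp only [towerWindow, Finset.mem_filter] at hP
  exact ⟨hP.2.2.1, hP.2.2.2⟩

/-- The tower window is bounded (`WindowBound … 2`, every `δ`; half of the card's K4): members are
admissible tower levels with `X ≤ N ≤ 2X`. [cite: IwaniecConversations2006, §7 (p0097:L15)] -/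
theorem windowBound_towerWindow (k : ℤ) (δ : ℝ) :
    (towerFamily k).WindowBound towerWindow δ 2 := by
  refine ⟨1, fun X hX D _ χ _ _ _ (N : ℕ+) hN => ?_⟩
  obtain ⟨htow, -, -, hlo, hhi⟩ := mem_towerWindow hX hN
  exact ⟨htow, hlo, hhi⟩

/-! ## The edge (card K1) and the decision displays -/

/-- **THE EDGE the card asks — E*-fam-□ (`TowerEdge`, the card's K1; OPEN, declared ¬(A)-strength
by the card):** the level-averaged E*-fam statement over the guarded tower window at proportion
`½ + η` — for all large `X` and all real primitive `χ_D`, `1 < D ≤ X^δ`, the harmonic proportion,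
over ALL even newforms of ALL tower levels `N ∈ [X,2X]` with `(N,D) = 1`, `χ_D(−N) = 1`, of those
with `L(½,f) ≥ (log N)⁻²` is at least `½ + η`. Shape (A) of `knife/fam/typer/TARGETS.md` on the
(L)-row datum `towerFamily k`. [cite: IwaniecConversations2006, §7 (7.5) and p0097:L15] -/
def TowerEdge (k : ℤ) (η δ : ℝ) : Prop :=
  (towerFamily k).EStarFamLevelAvg ((towerFamily k).ntWindow towerWindow) (1 / 2 + η) 2 δ

/-- **Decision display (the card's Assembly): tower edge ⇒ `L(1,χ_D) ≫ (log D)⁻⁴`.** Lapid–Rallis;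
K4 `EvenShareAvg towerWindow δ`; K3 `MixedOverTotalMassAvg towerWindow δ` and
`TwistedHalfAvg (ntWindow towerWindow) (1/2 − ε) 2 δ`; K1 `TowerEdge k η δ` with `ε < η` ⇒
`∃ c > 0, ∃ D₀, ∀ D ≥ D₀, ∀ real primitive χ mod D, c (log D)⁻⁴ ≤ L(1,χ)` — the decision theorem of
record `lOne_lowerBound_of_EStarFamLevelAvg_total` on the tower datum (the card's `example`).
[cite: IwaniecConversations2006, §7 (7.7)] -/
theorem lOne_lowerBound_of_towerEdge {k : ℤ} (hk : 2 ≤ k) (hLR : lapidRallis2003_theorem1_gl2Twist)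
    {η ε δ : ℝ} (hδ : 0 < δ) (hεη : ε < η)
    (hsh : (towerFamily k).EvenShareAvg towerWindow δ)
    (hmix : (towerFamily k).MixedOverTotalMassAvg towerWindow δ)
    (htw : (towerFamily k).TwistedHalfAvg ((towerFamily k).ntWindow towerWindow) (1 / 2 - ε) 2 δ)
    (hE : TowerEdge k η δ) :
    ∃ c : ℝ, 0 < c ∧ ∃ D₀ : ℕ, ∀ (D : ℕ) [NeZero D] (χ : DirichletCharacter ℂ D), D₀ ≤ D →
      χ.IsPrimitive → MulChar.IsQuadratic χ →
        c * ((Real.log D) ^ (2 * 2))⁻¹ ≤ (χ.LFunction 1).re :=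
  (towerFamily k).lOne_lowerBound_of_EStarFamLevelAvg_total hδ (by norm_num : (1 : ℝ) ≤ 2)
    (towerFamily_nonnegOn hk hLR) (windowBound_towerWindow k δ) (towerWindow_compatible k δ)
    hsh hmix htw hE (by linarith)

/-- The same in the summit vocabulary: `Zhang2022.Skeleton.LOneLowerBound 4`.
[cite: IwaniecConversations2006, §7 (7.7)] -/
theorem lOneLowerBound_four_of_towerEdge {k : ℤ} (hk : 2 ≤ k)
    (hLR : lapidRallis2003_theorem1_gl2Twist) {η ε δ : ℝ} (hδ : 0 < δ) (hεη : ε < η)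
    (hsh : (towerFamily k).EvenShareAvg towerWindow δ)
    (hmix : (towerFamily k).MixedOverTotalMassAvg towerWindow δ)
    (htw : (towerFamily k).TwistedHalfAvg ((towerFamily k).ntWindow towerWindow) (1 / 2 - ε) 2 δ)
    (hE : TowerEdge k η δ) :
    Skeleton.LOneLowerBound 4 := by
  refine lOneLowerBound_of_eventual ?_
  obtain ⟨c, hc, D₀, h⟩ := lOne_lowerBound_of_towerEdge hk hLR hδ hεη hsh hmix htw hE
  exact ⟨c, hc, D₀, fun D _ χ hD hprim hquad => h D χ hD hprim hquad⟩

/-- The same, also as `Zhang2022.Skeleton.ZeroFreeRegion 6` (σ > 1 − c (log D)⁻⁶ — weaker than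
`NoSiegelZeros`). [cite: IwaniecConversations2006, §7 (7.7)] -/
theorem zeroFreeRegion_six_of_towerEdge {k : ℤ} (hk : 2 ≤ k)
    (hLR : lapidRallis2003_theorem1_gl2Twist) {η ε δ : ℝ} (hδ : 0 < δ) (hεη : ε < η)
    (hsh : (towerFamily k).EvenShareAvg towerWindow δ)
    (hmix : (towerFamily k).MixedOverTotalMassAvg towerWindow δ)
    (htw : (towerFamily k).TwistedHalfAvg ((towerFamily k).ntWindow towerWindow) (1 / 2 - ε) 2 δ)
    (hE : TowerEdge k η δ) :
    Skeleton.ZeroFreeRegion 6 := by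
  refine zeroFreeRegion_of_eventual (A := 4) ?_
  obtain ⟨c, hc, D₀, h⟩ := lOne_lowerBound_of_towerEdge hk hLR hδ hεη hsh hmix htw hE
  exact ⟨c, hc, D₀, fun D _ χ hD hprim hquad => h D χ hD hprim hquad⟩

/-! ## Average-to-level pigeonhole (card P3) -/

/-- If the window average has proportion `≥ c`, some parameter in the window has proportion `≥ c`.
[cite: IwaniecConversations2006, §7 (p0097:L15)] -/
theorem exists_param_of_avg {ι : Type*} (W : Finset ι) (hW : W.Nonempty) (g e : ι → ℝ) (c : ℝ)
    (h : c * ∑ i ∈ W, e i ≤ ∑ i ∈ W, g i) : ∃ i ∈ W, c * e i ≤ g i := by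
  by_contra hcon
  push Not at hcon
  have hlt : ∑ i ∈ W, g i < ∑ i ∈ W, c * e i :=
    Finset.sum_lt_sum_of_nonempty hW fun i hi => hcon i hi
  rw [← Finset.mul_sum] at hlt
  linarith

end Literature.NumberTheory.LFunctions.CentralValueFamilyHalfEdge.SquareTower

end
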